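import Mathlib
import HarnessLib
import Summits.HubbardSuperconductivity.HubbardSuperconductivity.Theorems.KLProgrammeKLRegimeEngineV8DefsG7ValueLane
import Summits.HubbardSuperconductivity.HubbardSuperconductivity.Theorems.KLProgrammeKLRegimeEngineValueClausesV17FCrossFrame
import Summits.HubbardSuperconductivity.HubbardSuperconductivity.Theorems.KLProgrammeKLRegimeEngineIsoTupleV17FDoor

/-!
# K3 ENGINE-FLOW child (gen 8, stmt-HubbardSuperconductivity-20437 `KLRegimeEngineV17F2`), stub (c) `stub_engine_step_values`:
# the stub at `klEngGeo7` reduced to its RESIDUAL INPUTS, `Q`-generic (any `Q` with `Q.WF` and `Q.CR = (klEngQ5 P R).CR`, e.g. `klEngQ6 P R`,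
# the #12 package `klEngQ7 P R`) and threshold-generic (any `U ≤ U₀ ≤ klEngU₀4 P R c`, e.g. `klEngU₀6/7/8/9`)
# (cell gate-hubbard-kl, seat hubbard-kl-k3c2-p2 g8, value/(T) lane)

The registered text (frozen token set of plan g17 (R44): V17F2 ×6, #7 `klEngGeo7`, #8 `KernelNormsWt4`, #10 `klEngU₀9`, #12 `klEngQ7`) states stub (c)
at `(klEngGeo7, klEngQ7 P R)` under `U ≤ klEngU₀9 P R c` with the history `HistP klPredsV17F2 … 0 n`.  Every `Q`-package of the lineage has
`CR` equal to `(klEngQ5 P R).CR` (`raiseCE` touches `CE`, `S′` only) and every threshold is `≤ klEngU₀4`, so the lemmas below instantiate at the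
registered tokens by `rfl` / one `le_trans` (by-name one-liners follow `…EngineV8DefsQ7`).  What is LEFT of stub (c):

* **`stepValuesV17F2_of_residue_Q`** — the four value conjuncts at `(klEngGeo7, Q, n)` from (i) `hlad` (E2-F2)ₙ (Wick-tower composition, door
  `pairLadderStepAtV17F2_of_wickTower_fwd` p528604), (ii) `hout` the OUT-OF-CLASS cross-frame (E2″-F) rows, (iii) `hE5` (E5-F)ₙ; the (B1-F) envelope
  at `n−1` is READ FROM THE HISTORY and the two smallness lines from `U ≤ U₀ ≤ klEngU₀4`;
* **`stepValuesV17F2_of_residue_sameFrame_Q`** — (ii) split into SAME-FRAME rows at `K_n` + the FRAME-SHIFT response `≤ frameShiftBar`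
  (`…ValueClausesV17FCrossFrame` p528154; `frameShiftBar_le_CR_mul_sq`);
* **`stepValuesV17F2_of_residue_towerLine_Q`** — (iii) REPLACED by the (E5-F)ₙ door's inputs (`…EngineIsoTupleV17FDoor` p533661): the tower's
  single iso-tuple line `≤ a·U + b·(Klam U)²` (`2a ≤ CF`, `b ≤ CF`), two bare-ball points `q, q₃` with `4⁻¹ < |q + q₃|_𝕋`, the (I-F jets)
  smallness `R.Gfr 0·|U| ≤ klE0/32`, and the accumulated-rows smallness `≤ U/2` — the (E2″-F)ₙ row the door reads at `j = n` is DERIVED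
  inside from (i)+(ii);
* **`stepValuesV17F2_band_of_signBlind_Q`** / **`…_band_of_sameFrame_frameShift_Q`** / **`…_band_towerLine_Q`** — in the thermal band
  `nScales β ≤ n + T` the residue is ONE sign-blind bound `Cp·(Klam U)²` (`Cp·4^T ≤ 2^80`) (+ (E5-F)ₙ, or + the door inputs).

§4 (appended): `stepValuesV17F2_of_residue_gen` / `_towerLine_gen` — fully `Q`-generic (smallness lines as hypotheses) for `CR`-raised packages (v2 `klEngQ8`).

Bookkeeping (compositions of p528793/p531775/p528154/p533661); nothing about the model is asserted; nothing asserts superconductivity.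
-/

noncomputable section

namespace Summit.HubbardSuperconductivity.HubbardSuperconductivity.Theorems.KLRegimeSplit

set_option linter.dupNamespace false -- summit = problem name (single-conjunct summit), D-0017

open Real Finset Literature.MathematicalPhysics.QuantumLattice Literature.Probability.LatticeModels
open Summit.HubbardSuperconductivity.HubbardSuperconductivity.Theorems.KLProgrammeLegKernels
open Summit.HubbardSuperconductivity.HubbardSuperconductivity.Theorems.EngineV8

section Model

variable {L M : ℕ} [NeZero L] [NeZero M] {P : SplitConsts} {Q : EngConsts} {R : RenConsts} {c β U μ U₀ : ℝ} {n : ℕ}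

/-- `frameShiftBar P Q U n ≤ Q.CR·(Klam U)²` (`Q.CR ≥ 0`; the profile `4^{-n} ≤ 1`). -/
theorem frameShiftBar_le_CR_mul_sq {P : SplitConsts} {Q : EngConsts} (hQ : 0 ≤ Q.CR) (U : ℝ) (n : ℕ) :
    frameShiftBar P Q U n ≤ Q.CR * (P.Klam * U) ^ 2 := by
  unfold frameShiftBar
  have h1 : ((4 : ℝ)⁻¹) ^ n ≤ 1 := pow_le_one₀ (by norm_num) (by norm_num)
  have h2 : 0 ≤ Q.CR * (P.Klam * U) ^ 2 := mul_nonneg hQ (sq_nonneg _)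
  nlinarith

/-- The two smallness lines of the value lane at any lineage package `Q` (`Q.CR = (klEngQ5 P R).CR`) under `U ≤ U₀ ≤ klEngU₀4 P R c`. -/
theorem klvrF_smallness_of_le_klEngU₀4 (hP : P.WF) (hR : R.WF) (hQCR : Q.CR = (klEngQ5 P R).CR) (hU : 0 < U)
    (hU₀ : U₀ ≤ klEngU₀4 P R c) (hUle : U ≤ U₀) :
    (P.C_W + klLegKappa * Q.CR * P.Klam ^ 3) * |U| ≤ 1 / 10 ∧ |U| * klEngGeo7.bhi ≤ 1 / 8 := by
  refine ⟨?_, ?_⟩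
  · rw [hQCR]; exact klEng_pairTolerance5_mul_le_of_le_klEngU₀4 hP hR hU (hUle.trans hU₀)
  · rw [klEngGeo7_bhi, klEngGeo6_bhi, klEngGeo5_bhi, klEngGeo4_bhi, klEngGeo3_bhi]
    exact abs_mul_two_pow_24_le_of_le_klEngU₀4 hU (hUle.trans hU₀)

/-! ## §1 Stub (c) from (E2-F2)ₙ + out-of-class rows + (E5-F)ₙ -/

/-- **Stub (c) at `(klEngGeo7, Q)` from its three residual inputs**, history-keyed: (B1-F)(n−1) = `(hhist (n−1) _).1.1`. -/
theorem stepValuesV17F2_of_residue_Q (hP : P.WF) (hR : R.WF) (hQ : Q.WF) (hQCR : Q.CR = (klEngQ5 P R).CR) (hU : 0 < U)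
    (hU₀ : U₀ ≤ klEngU₀4 P R c) (hUle : U ≤ U₀) (hn1 : 1 ≤ n)
    (hhist : HistP klPredsV17F2 L M klEngGeo7 P Q R β U μ 0 n)
    (hlad : PairLadderStepAtV17F2 L M klEngGeo7 P Q β U μ n)
    (hout : ∀ Qm : TorusSite 2 L, ¬ IsPairClassAt L Qm n → ∀ k ∈ klBall L μ 0, ∀ k' ∈ klBall L μ 0,
      ‖klPairAmplitude L M β U μ (klFlowFrameU L M β U μ n) n Qm k k' -
          klPairAmplitude L M β U μ (klFlowFrameU L M β U μ (n - 1)) (n - 1) Qm k k'‖ ≤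
        gainBar klEngGeo7 P U n (klTorusNorm L Qm) (klTorusNorm L (k - k')) (klTorusNorm L (k + k' - Qm)) +
          eremBar klEngGeo7 P Q U β L (n - 1) + thermalBar klEngGeo7 P U β n +
            legDressBarQ2 klEngGeo7 P Q U n (legSliceCountT L β μ (klFlowFrameU L M β U μ n) n ![k', Qm - k', Qm - k, k]) +
              frameShiftBar P Q U n)
    (hE5 : IsoTupleL1AtV17F L M klEngGeo7 P β U μ n) :
    PairLadderStepAtV17F2 L M klEngGeo7 P Q β U μ n ∧ PairValueIncrementAtV17F L M klEngGeo7 P Q β U μ n ∧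
      QuarticValueIncrementAtV17F L M klEngGeo7 P Q β U μ n ∧ IsoTupleL1AtV17F L M klEngGeo7 P β U μ n := by
  have harr : PairArrayAtV17F L M P Q β U μ (n - 1) :=
    (((histP_klPredsV17F2_iff L M klEngGeo7 P Q R β U μ 0 n).1 hhist) (n - 1) (by omega)).1.1
  obtain ⟨hcU', hUb⟩ := klvrF_smallness_of_le_klEngU₀4 hP hR hQCR hU hU₀ hUle
  exact klvrF_stepValues_of_reduced_klEng7 hP hQ hn1 hlad harr hcU' hUb hout hE5

/-- **The same with the out-of-class rows split into SAME-FRAME rows at `K_n` + the frame-shift door.** -/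
theorem stepValuesV17F2_of_residue_sameFrame_Q (hP : P.WF) (hR : R.WF) (hQ : Q.WF) (hQCR : Q.CR = (klEngQ5 P R).CR) (hU : 0 < U)
    (hU₀ : U₀ ≤ klEngU₀4 P R c) (hUle : U ≤ U₀) (hn1 : 1 ≤ n)
    (hhist : HistP klPredsV17F2 L M klEngGeo7 P Q R β U μ 0 n)
    (hlad : PairLadderStepAtV17F2 L M klEngGeo7 P Q β U μ n)
    (hsame : ∀ Qm : TorusSite 2 L, ¬ IsPairClassAt L Qm n → ∀ k ∈ klBall L μ 0, ∀ k' ∈ klBall L μ 0,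
      ‖klPairAmplitude L M β U μ (klFlowFrameU L M β U μ n) n Qm k k' -
          klPairAmplitude L M β U μ (klFlowFrameU L M β U μ n) (n - 1) Qm k k'‖ ≤
        gainBar klEngGeo7 P U n (klTorusNorm L Qm) (klTorusNorm L (k - k')) (klTorusNorm L (k + k' - Qm)) +
          eremBar klEngGeo7 P Q U β L (n - 1) + thermalBar klEngGeo7 P U β n +
            legDressBarQ2 klEngGeo7 P Q U n (legSliceCountT L β μ (klFlowFrameU L M β U μ n) n ![k', Qm - k', Qm - k, k]))
    (hshift : ∀ Qm : TorusSite 2 L, ¬ IsPairClassAt L Qm n → ∀ k ∈ klBall L μ 0, ∀ k' ∈ klBall L μ 0,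
      ‖klPairAmplitude L M β U μ (klFlowFrameU L M β U μ n) (n - 1) Qm k k' -
          klPairAmplitude L M β U μ (klFlowFrameU L M β U μ (n - 1)) (n - 1) Qm k k'‖ ≤ frameShiftBar P Q U n)
    (hE5 : IsoTupleL1AtV17F L M klEngGeo7 P β U μ n) :
    PairLadderStepAtV17F2 L M klEngGeo7 P Q β U μ n ∧ PairValueIncrementAtV17F L M klEngGeo7 P Q β U μ n ∧
      QuarticValueIncrementAtV17F L M klEngGeo7 P Q β U μ n ∧ IsoTupleL1AtV17F L M klEngGeo7 P β U μ n :=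
  stepValuesV17F2_of_residue_Q hP hR hQ hQCR hU hU₀ hUle hn1 hhist hlad (klvrF_outClass_of_sameFrame_frameShift hsame hshift) hE5

/-! ## §2 Stub (c) with (E5-F)ₙ replaced by the (E5-F)ₙ door's inputs -/

/-- **Stub (c) at `(klEngGeo7, Q)` from (E2-F2)ₙ + out-of-class rows + the TOWER's single-tuple line + door data** (`n ≤ n_β + 1`):
(E5-F)ₙ is discharged by `isoTupleL1AtV17F_of_fixedTuple_le_hist`, whose (E2″-F)ₙ input is derived here from (E2-F2)ₙ (in class) and `hout`. -/
theorem stepValuesV17F2_of_residue_towerLine_Q (hP : P.WF) (hR : R.WF) (hQ : Q.WF) (hQCR : Q.CR = (klEngQ5 P R).CR) (hU : 0 < U)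
    (hU₀ : U₀ ≤ klEngU₀4 P R c) (hUle : U ≤ U₀) (hn1 : 1 ≤ n) (hn : n ≤ nScales β + 1)
    (hhist : HistP klPredsV17F2 L M klEngGeo7 P Q R β U μ 0 n)
    (hlad : PairLadderStepAtV17F2 L M klEngGeo7 P Q β U μ n)
    (hout : ∀ Qm : TorusSite 2 L, ¬ IsPairClassAt L Qm n → ∀ k ∈ klBall L μ 0, ∀ k' ∈ klBall L μ 0,
      ‖klPairAmplitude L M β U μ (klFlowFrameU L M β U μ n) n Qm k k' -
          klPairAmplitude L M β U μ (klFlowFrameU L M β U μ (n - 1)) (n - 1) Qm k k'‖ ≤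
        gainBar klEngGeo7 P U n (klTorusNorm L Qm) (klTorusNorm L (k - k')) (klTorusNorm L (k + k' - Qm)) +
          eremBar klEngGeo7 P Q U β L (n - 1) + thermalBar klEngGeo7 P U β n +
            legDressBarQ2 klEngGeo7 P Q U n (legSliceCountT L β μ (klFlowFrameU L M β U μ n) n ![k', Qm - k', Qm - k, k]) +
              frameShiftBar P Q U n)
    {a b : ℝ}
    (hfix : ∀ m : ℕ, n ≤ m → ∀ Ω ∈ bgmSectorSet L M (klIsoFamily L M β μ (klFlowFrameU L M β U μ n) klE0 m) 4,
      ∀ x₁ : SpaceTimeIdx L M,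
        fixedTupleL1 L M β 3 (klIsoKernelAt L M β U μ (klFlowFrameU L M β U μ n) n m) Ω x₁ ≤ a * U + b * (P.Klam * U) ^ 2)
    (ha : 2 * a ≤ klEngGeo7.CF) (hb : b ≤ klEngGeo7.CF)
    {q q₃ : TorusSite 2 L} (hq : q ∈ klBall L μ 0) (hq₃ : q₃ ∈ klBall L μ 0) (hqq : 4⁻¹ < klTorusNorm L (q + q₃))
    (hUκ : R.Gfr 0 * |U| ≤ 1 / 32 * klE0)
    (hsmall : initDevBar klEngGeo7 U + legDressBarQ2 klEngGeo7 P Q U 0 4 +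
        (3 * klEngGeo7.CF * (P.Klam * U) ^ 2 +
          ((klEngGeo7.cloc * P.Klam ^ 2 * (1 - (4 : ℝ) ^ (-klEngGeo7.θ))⁻¹ + 2 * Q.CR * P.Klam ^ 3 * |U|) * U ^ 2 +
              ∑ j ∈ range n, Q.CL β j / L) +
            7 / 3 * (klEngGeo7.CF * (P.Klam * U) ^ 2) + 20 * (Q.CR * ((P.Klam * U) ^ 2 + (P.Klam * |U|) ^ 3)) +
              4 / 3 * (Q.CR * (P.Klam * U) ^ 2)) ≤ U / 2) :
    PairLadderStepAtV17F2 L M klEngGeo7 P Q β U μ n ∧ PairValueIncrementAtV17F L M klEngGeo7 P Q β U μ n ∧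
      QuarticValueIncrementAtV17F L M klEngGeo7 P Q β U μ n ∧ IsoTupleL1AtV17F L M klEngGeo7 P β U μ n := by
  have harr : PairArrayAtV17F L M P Q β U μ (n - 1) :=
    (((histP_klPredsV17F2_iff L M klEngGeo7 P Q R β U μ 0 n).1 hhist) (n - 1) (by omega)).1.1
  obtain ⟨hcU', hUb⟩ := klvrF_smallness_of_le_klEngU₀4 hP hR hQCR hU hU₀ hUle
  have hE2'' : PairValueIncrementAtV17F L M klEngGeo7 P Q β U μ n :=
    klvrF_pairValueIncrementAtV17F_of_inClass_outClass
      (fun Qm hQm => klvrF_pairValueIncrement_inClass_klEng7 hP hQ hn1 hlad harr hcU' hUb hQm) hout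
  have hE5 : IsoTupleL1AtV17F L M klEngGeo7 P β U μ n :=
    isoTupleL1AtV17F_of_fixedTuple_le_hist klEngGeo7_wf hP hQ hR hU hn1 hn hfix ha hb hhist hE2'' hq hq₃ hqq hUκ hsmall
  exact klvrF_stepValues_of_reduced_klEng7 hP hQ hn1 hlad harr hcU' hUb hout hE5

/-! ## §3 The thermal band -/

/-- **Stub (c) in the THERMAL BAND from ONE sign-blind bound + (E5-F)ₙ** (`nScales β ≤ n + T`, `0 ≤ Cp`, `Cp·4^T ≤ 2^80`): no ladder data,
no rows, no history are needed on the last `T + 1` scales (incl. the extended scale `n = n_β + 1`). -/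
theorem stepValuesV17F2_band_of_signBlind_Q (hP : P.WF) (hQ : Q.WF) (hn1 : 1 ≤ n) {T : ℕ} (hband : nScales β ≤ n + T) {Cp : ℝ}
    (hCp : 0 ≤ Cp) (hCpT : Cp * 4 ^ T ≤ 2 ^ 80)
    (hpair : ∀ Qm : TorusSite 2 L, ∀ k ∈ klBall L μ 0, ∀ k' ∈ klBall L μ 0,
      ‖klPairAmplitude L M β U μ (klFlowFrameU L M β U μ n) n Qm k k' -
          klPairAmplitude L M β U μ (klFlowFrameU L M β U μ (n - 1)) (n - 1) Qm k k'‖ ≤ Cp * (P.Klam * U) ^ 2)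
    (hE5 : IsoTupleL1AtV17F L M klEngGeo7 P β U μ n) :
    PairLadderStepAtV17F2 L M klEngGeo7 P Q β U μ n ∧ PairValueIncrementAtV17F L M klEngGeo7 P Q β U μ n ∧
      QuarticValueIncrementAtV17F L M klEngGeo7 P Q β U μ n ∧ IsoTupleL1AtV17F L M klEngGeo7 P β U μ n :=
  klg7F_stepValues_of_signBlind_band hP hQ hn1 hband hCp hCpT hpair hE5

/-- **The band from a sign-blind SAME-FRAME increment bound + a sign-blind FRAME-SHIFT bound + (E5-F)ₙ**:
`‖𝒞_n[K_n] − 𝒞_{n−1}[K_n]‖ ≤ C₁·(Klam U)²`, `‖𝒞_{n−1}[K_n] − 𝒞_{n−1}[K_{n−1}]‖ ≤ C₂·(Klam U)²` on the bare ball (`(C₁ + C₂)·4^T ≤ 2^80`;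
e.g. `C₂ = Q.CR` by `frameShiftBar_le_CR_mul_sq`). -/
theorem stepValuesV17F2_band_of_sameFrame_frameShift_Q (hP : P.WF) (hQ : Q.WF) (hn1 : 1 ≤ n) {T : ℕ} (hband : nScales β ≤ n + T)
    {C₁ C₂ : ℝ} (hC₁ : 0 ≤ C₁) (hC₂ : 0 ≤ C₂) (hCT : (C₁ + C₂) * 4 ^ T ≤ 2 ^ 80)
    (hsame : ∀ Qm : TorusSite 2 L, ∀ k ∈ klBall L μ 0, ∀ k' ∈ klBall L μ 0,
      ‖klPairAmplitude L M β U μ (klFlowFrameU L M β U μ n) n Qm k k' -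
          klPairAmplitude L M β U μ (klFlowFrameU L M β U μ n) (n - 1) Qm k k'‖ ≤ C₁ * (P.Klam * U) ^ 2)
    (hshift : ∀ Qm : TorusSite 2 L, ∀ k ∈ klBall L μ 0, ∀ k' ∈ klBall L μ 0,
      ‖klPairAmplitude L M β U μ (klFlowFrameU L M β U μ n) (n - 1) Qm k k' -
          klPairAmplitude L M β U μ (klFlowFrameU L M β U μ (n - 1)) (n - 1) Qm k k'‖ ≤ C₂ * (P.Klam * U) ^ 2)
    (hE5 : IsoTupleL1AtV17F L M klEngGeo7 P β U μ n) :
    PairLadderStepAtV17F2 L M klEngGeo7 P Q β U μ n ∧ PairValueIncrementAtV17F L M klEngGeo7 P Q β U μ n ∧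
      QuarticValueIncrementAtV17F L M klEngGeo7 P Q β U μ n ∧ IsoTupleL1AtV17F L M klEngGeo7 P β U μ n := by
  refine stepValuesV17F2_band_of_signBlind_Q hP hQ hn1 hband (add_nonneg hC₁ hC₂) hCT (fun Qm k hk k' hk' => ?_) hE5
  have h := klvrF_crossFrame_norm_le (L := L) (M := M) (β := β) (U := U) (μ := μ) (klFlowFrameU L M β U μ n)
    (klFlowFrameU L M β U μ (n - 1)) n (n - 1) Qm k k'
  have h1 := hsame Qm k hk k' hk'
  have h2 := hshift Qm k hk k' hk'
  linarith

/-- **The band with (E5-F)ₙ from the door**: ONE sign-blind cross-frame bound `Cp·(Klam U)²` + the tower line + door data; the (E2″-F)ₙ row the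
door reads at `j = n` is the band door's own output. -/
theorem stepValuesV17F2_band_towerLine_Q (hP : P.WF) (hQ : Q.WF) (hR : R.WF) (hU : 0 < U) (hn1 : 1 ≤ n) (hn : n ≤ nScales β + 1) {T : ℕ}
    (hband : nScales β ≤ n + T) {Cp : ℝ} (hCp : 0 ≤ Cp) (hCpT : Cp * 4 ^ T ≤ 2 ^ 80)
    (hpair : ∀ Qm : TorusSite 2 L, ∀ k ∈ klBall L μ 0, ∀ k' ∈ klBall L μ 0,
      ‖klPairAmplitude L M β U μ (klFlowFrameU L M β U μ n) n Qm k k' -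
          klPairAmplitude L M β U μ (klFlowFrameU L M β U μ (n - 1)) (n - 1) Qm k k'‖ ≤ Cp * (P.Klam * U) ^ 2)
    (hhist : HistP klPredsV17F2 L M klEngGeo7 P Q R β U μ 0 n)
    {a b : ℝ}
    (hfix : ∀ m : ℕ, n ≤ m → ∀ Ω ∈ bgmSectorSet L M (klIsoFamily L M β μ (klFlowFrameU L M β U μ n) klE0 m) 4,
      ∀ x₁ : SpaceTimeIdx L M,
        fixedTupleL1 L M β 3 (klIsoKernelAt L M β U μ (klFlowFrameU L M β U μ n) n m) Ω x₁ ≤ a * U + b * (P.Klam * U) ^ 2)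
    (ha : 2 * a ≤ klEngGeo7.CF) (hb : b ≤ klEngGeo7.CF)
    {q q₃ : TorusSite 2 L} (hq : q ∈ klBall L μ 0) (hq₃ : q₃ ∈ klBall L μ 0) (hqq : 4⁻¹ < klTorusNorm L (q + q₃))
    (hUκ : R.Gfr 0 * |U| ≤ 1 / 32 * klE0)
    (hsmall : initDevBar klEngGeo7 U + legDressBarQ2 klEngGeo7 P Q U 0 4 +
        (3 * klEngGeo7.CF * (P.Klam * U) ^ 2 +
          ((klEngGeo7.cloc * P.Klam ^ 2 * (1 - (4 : ℝ) ^ (-klEngGeo7.θ))⁻¹ + 2 * Q.CR * P.Klam ^ 3 * |U|) * U ^ 2 +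
              ∑ j ∈ range n, Q.CL β j / L) +
            7 / 3 * (klEngGeo7.CF * (P.Klam * U) ^ 2) + 20 * (Q.CR * ((P.Klam * U) ^ 2 + (P.Klam * |U|) ^ 3)) +
              4 / 3 * (Q.CR * (P.Klam * U) ^ 2)) ≤ U / 2) :
    PairLadderStepAtV17F2 L M klEngGeo7 P Q β U μ n ∧ PairValueIncrementAtV17F L M klEngGeo7 P Q β U μ n ∧
      QuarticValueIncrementAtV17F L M klEngGeo7 P Q β U μ n ∧ IsoTupleL1AtV17F L M klEngGeo7 P β U μ n := by
  have hT : ∀ Qm : TorusSite 2 L, ∀ k ∈ klBall L μ 0, ∀ k' ∈ klBall L μ 0,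
      ‖klPairAmplitude L M β U μ (klFlowFrameU L M β U μ n) n Qm k k' -
          klPairAmplitude L M β U μ (klFlowFrameU L M β U μ (n - 1)) (n - 1) Qm k k'‖ ≤ thermalBar klEngGeo7 P U β n :=
    fun Qm k hk k' hk' => klg7_band_le_thermalBar hCp hCpT hband (hpair Qm k hk k' hk')
  have hE2'' : PairValueIncrementAtV17F L M klEngGeo7 P Q β U μ n := (klbandF_values_of_le_thermalBar klEngGeo7_wf hP hQ hT).1
  have hE5 : IsoTupleL1AtV17F L M klEngGeo7 P β U μ n :=
    isoTupleL1AtV17F_of_fixedTuple_le_hist klEngGeo7_wf hP hQ hR hU hn1 hn hfix ha hb hhist hE2'' hq hq₃ hqq hUκ hsmall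
  exact stepValuesV17F2_band_of_signBlind_Q hP hQ hn1 hband hCp hCpT hpair hE5

/-! ## §4 (appended) Fully `Q`-generic forms — the two smallness lines as hypotheses (for `CR`-raised packages such as v2's `klEngQ8 = Q7.withCR …`,
where `Q.CR = (klEngQ5 P R).CR` no longer holds and the U-door is DefsU10's CR-keyed `min`) -/

/-- **Stub (c) at `(klEngGeo7, Q)` from its three residual inputs, ANY `Q` with `Q.WF`**, the two smallness lines
`(C_W + klLegKappa·Q.CR·Klam³)·|U| ≤ 1/10` and `|U|·klEngGeo7.bhi ≤ 1/8` supplied by the caller's U-door; (B1-F)(n−1) from the history. -/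
theorem stepValuesV17F2_of_residue_gen (hP : P.WF) (hQ : Q.WF) (hn1 : 1 ≤ n)
    (hcU' : (P.C_W + klLegKappa * Q.CR * P.Klam ^ 3) * |U| ≤ 1 / 10) (hUb : |U| * klEngGeo7.bhi ≤ 1 / 8)
    (hhist : HistP klPredsV17F2 L M klEngGeo7 P Q R β U μ 0 n)
    (hlad : PairLadderStepAtV17F2 L M klEngGeo7 P Q β U μ n)
    (hout : ∀ Qm : TorusSite 2 L, ¬ IsPairClassAt L Qm n → ∀ k ∈ klBall L μ 0, ∀ k' ∈ klBall L μ 0,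
      ‖klPairAmplitude L M β U μ (klFlowFrameU L M β U μ n) n Qm k k' -
          klPairAmplitude L M β U μ (klFlowFrameU L M β U μ (n - 1)) (n - 1) Qm k k'‖ ≤
        gainBar klEngGeo7 P U n (klTorusNorm L Qm) (klTorusNorm L (k - k')) (klTorusNorm L (k + k' - Qm)) +
          eremBar klEngGeo7 P Q U β L (n - 1) + thermalBar klEngGeo7 P U β n +
            legDressBarQ2 klEngGeo7 P Q U n (legSliceCountT L β μ (klFlowFrameU L M β U μ n) n ![k', Qm - k', Qm - k, k]) +
              frameShiftBar P Q U n)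
    (hE5 : IsoTupleL1AtV17F L M klEngGeo7 P β U μ n) :
    PairLadderStepAtV17F2 L M klEngGeo7 P Q β U μ n ∧ PairValueIncrementAtV17F L M klEngGeo7 P Q β U μ n ∧
      QuarticValueIncrementAtV17F L M klEngGeo7 P Q β U μ n ∧ IsoTupleL1AtV17F L M klEngGeo7 P β U μ n := by
  have harr : PairArrayAtV17F L M P Q β U μ (n - 1) :=
    (((histP_klPredsV17F2_iff L M klEngGeo7 P Q R β U μ 0 n).1 hhist) (n - 1) (by omega)).1.1
  exact klvrF_stepValues_of_reduced_klEng7 hP hQ hn1 hlad harr hcU' hUb hout hE5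

/-- **The fully `Q`-generic tower-line form** (class #6 line + (II) points + (III) smallness supplied, the LINEAR door; `n ≤ n_β + 1`). -/
theorem stepValuesV17F2_of_residue_towerLine_gen (hP : P.WF) (hQ : Q.WF) (hR : R.WF) (hU : 0 < U) (hn1 : 1 ≤ n) (hn : n ≤ nScales β + 1)
    (hcU' : (P.C_W + klLegKappa * Q.CR * P.Klam ^ 3) * |U| ≤ 1 / 10) (hUb : |U| * klEngGeo7.bhi ≤ 1 / 8)
    (hhist : HistP klPredsV17F2 L M klEngGeo7 P Q R β U μ 0 n)
    (hlad : PairLadderStepAtV17F2 L M klEngGeo7 P Q β U μ n)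
    (hout : ∀ Qm : TorusSite 2 L, ¬ IsPairClassAt L Qm n → ∀ k ∈ klBall L μ 0, ∀ k' ∈ klBall L μ 0,
      ‖klPairAmplitude L M β U μ (klFlowFrameU L M β U μ n) n Qm k k' -
          klPairAmplitude L M β U μ (klFlowFrameU L M β U μ (n - 1)) (n - 1) Qm k k'‖ ≤
        gainBar klEngGeo7 P U n (klTorusNorm L Qm) (klTorusNorm L (k - k')) (klTorusNorm L (k + k' - Qm)) +
          eremBar klEngGeo7 P Q U β L (n - 1) + thermalBar klEngGeo7 P U β n +
            legDressBarQ2 klEngGeo7 P Q U n (legSliceCountT L β μ (klFlowFrameU L M β U μ n) n ![k', Qm - k', Qm - k, k]) +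
              frameShiftBar P Q U n)
    {a b : ℝ}
    (hfix : ∀ m : ℕ, n ≤ m → ∀ Ω ∈ bgmSectorSet L M (klIsoFamily L M β μ (klFlowFrameU L M β U μ n) klE0 m) 4,
      ∀ x₁ : SpaceTimeIdx L M,
        fixedTupleL1 L M β 3 (klIsoKernelAt L M β U μ (klFlowFrameU L M β U μ n) n m) Ω x₁ ≤ a * U + b * (P.Klam * U) ^ 2)
    (hab : a + b * P.Klam ^ 2 * U ≤ klEngGeo7.CF / 2)
    {q q₃ : TorusSite 2 L} (hq : q ∈ klBall L μ 0) (hq₃ : q₃ ∈ klBall L μ 0) (hqq : 4⁻¹ < klTorusNorm L (q + q₃))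
    (hUκ : R.Gfr 0 * |U| ≤ 1 / 32 * klE0)
    (hsmall : initDevBar klEngGeo7 U + legDressBarQ2 klEngGeo7 P Q U 0 4 +
        (3 * klEngGeo7.CF * (P.Klam * U) ^ 2 +
          ((klEngGeo7.cloc * P.Klam ^ 2 * (1 - (4 : ℝ) ^ (-klEngGeo7.θ))⁻¹ + 2 * Q.CR * P.Klam ^ 3 * |U|) * U ^ 2 +
              ∑ j ∈ range n, Q.CL β j / L) +
            7 / 3 * (klEngGeo7.CF * (P.Klam * U) ^ 2) + 20 * (Q.CR * ((P.Klam * U) ^ 2 + (P.Klam * |U|) ^ 3)) +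
              4 / 3 * (Q.CR * (P.Klam * U) ^ 2)) ≤ U / 2) :
    PairLadderStepAtV17F2 L M klEngGeo7 P Q β U μ n ∧ PairValueIncrementAtV17F L M klEngGeo7 P Q β U μ n ∧
      QuarticValueIncrementAtV17F L M klEngGeo7 P Q β U μ n ∧ IsoTupleL1AtV17F L M klEngGeo7 P β U μ n := by
  have harr : PairArrayAtV17F L M P Q β U μ (n - 1) :=
    (((histP_klPredsV17F2_iff L M klEngGeo7 P Q R β U μ 0 n).1 hhist) (n - 1) (by omega)).1.1
  have hE2'' : PairValueIncrementAtV17F L M klEngGeo7 P Q β U μ n :=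
    klvrF_pairValueIncrementAtV17F_of_inClass_outClass
      (fun Qm hQm => klvrF_pairValueIncrement_inClass_klEng7 hP hQ hn1 hlad harr hcU' hUb hQm) hout
  have hE5 : IsoTupleL1AtV17F L M klEngGeo7 P β U μ n :=
    isoTupleL1AtV17F_of_fixedTuple_le_linear_hist klEngGeo7_wf hP hQ hR hU hn1 hn hfix hab hhist hE2'' hq hq₃ hqq hUκ hsmall
  exact klvrF_stepValues_of_reduced_klEng7 hP hQ hn1 hlad harr hcU' hUb hout hE5

end Model

end Summit.HubbardSuperconductivity.HubbardSuperconductivity.Theorems.KLRegimeSplit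

end
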